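import Literature.NumberTheory.Transcendental.KZDilationBakerSectorComplexPrep
import Literature.NumberTheory.Transcendental.BakerRelationDecomposition
import HarnessLib

/-!
# The complex Baker sector of the dilation pencil, II: Baker's theorem on the polar part

For real algebraic pole data `(p_k, q_k)` (poles `1/(p_k + iq_k)`), residues `c_k = γ_k + iδ_k`
and `w_k(x) = 1 − (p_k + iq_k)x`, the real polar integrand is
`σ(x) = Σ_k Re(c_k · (−(p_k+iq_k)/w_k(x))) = Σ_k (γ_k(−p_k + (p_k²+q_k²)x) + δ_k q_k)/m_k(x)`,
`m_k = |w_k|²`, with primitive `Σ_k Re(c_k log w_k)`. **Theorem** (`polar_decomposition`): if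
`r + Σ_k Re(c_k log w_k(1)) = 0` with `r` real algebraic (the vanishing cube period of
`ρ' + σ`, `r = ρ(1) − ρ(0)`), then `r = 0` and `σ` DECOMPOSES along exact relations:
  `σ = Σ_j (a_j · Σ_k e_{jk} m_k'/(2m_k) − b_j · Σ_k f_{jk} (arg w_k)')`
with real algebraic `a_j, b_j`, RATIONAL `e_{jk}, f_{jk}`, and the EXACT relations
`Σ_k e_{jk} log m_k(1) = 0`, `Σ_k f_{jk} arg w_k(1) = 0` (`j ∈ Fin A ⊕ Fin A`). Proof: write
`Re(c ℓ) = (c ℓ + c̄ ℓ̄)/2`, `ℓ̄_k = log w̄_k` (`w̄ = w_{p,−q}`), apply the complex Baker decomposition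
(`baker_decomposition_complex`) to the family `(log w_k(1), log w̄_k(1))_k`, and take real and
imaginary parts (`e = N_{inl} + N_{inr}`, `f = N_{inl} − N_{inr}`). The two exact relations feed
the logarithmic and the arctangent sector lifts respectively (file III).

Everything is proved; no `def`, no named fact.

## References
* A. Baker, *Transcendental Number Theory* (1975), Thm. 2.1. [`Baker1975`]
-/

noncomputable section

open Set Filter MvPolynomial Complex
open scoped BigOperators Topology Real ComplexConjugate
open Literature.ModelTheory.ExponentialFields

namespace Literature.NumberTheory.Transcendental

namespace KZ.BakerSectorComplex

/-- `(z + conj z)/2`-bookkeeping: `Re z` as a complex number. [folklore] -/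
theorem ofReal_re_eq_add_conj_half (z : ℂ) :
    ((z.re : ℝ) : ℂ) = z * (((2:ℝ)⁻¹ : ℝ) : ℂ) + conj z * (((2:ℝ)⁻¹ : ℝ) : ℂ) := by
  rw [← add_mul, Complex.add_conj]
  push_cast
  ring

/-- **Baker's theorem on the polar part: decomposition along exact relations.** See the module
docstring. [cite: Baker1975, Theorem 2.1] -/
theorem polar_decomposition {A : ℕ} {p q γ δ : Fin A → ℝ}
    (hp : ∀ k, IsAlgebraic ℚ (p k)) (hq : ∀ k, IsAlgebraic ℚ (q k))
    (hγ : ∀ k, IsAlgebraic ℚ (γ k)) (hδ : ∀ k, IsAlgebraic ℚ (δ k))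
    (hslit1 : ∀ k, 0 < 1 - p k * 1 ∨ q k * 1 ≠ 0)
    {r : ℝ} (hr : IsAlgebraic ℚ r)
    (hrel : r + ∑ k, (((γ k : ℂ) + (δ k : ℂ) * I) *
        Complex.log ((1 : ℂ) - ((p k : ℂ) + (q k : ℂ) * I) * ((1:ℝ) : ℂ))).re = 0) :
    r = 0 ∧ ∃ (aR aI : (Fin A ⊕ Fin A) → ℝ) (e f : (Fin A ⊕ Fin A) → Fin A → ℚ),
      (∀ j, IsAlgebraic ℚ (aR j)) ∧ (∀ j, IsAlgebraic ℚ (aI j)) ∧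
      (∀ j, ∑ k, (e j k : ℝ) * Real.log ((1 - p k * 1) ^ 2 + (q k * 1) ^ 2) = 0) ∧
      (∀ j, ∑ k, (f j k : ℝ) *
          Complex.arg ((1 : ℂ) - ((p k : ℂ) + (q k : ℂ) * I) * ((1:ℝ) : ℂ)) = 0) ∧
      ∀ x : ℝ, (∀ k, 0 < 1 - p k * x ∨ q k * x ≠ 0) →
        (∑ k, (γ k * (-p k + (p k ^ 2 + q k ^ 2) * x) + δ k * q k) /
            ((1 - p k * x) ^ 2 + (q k * x) ^ 2)) =
          ∑ j, (aR j * ∑ k, (e j k : ℝ) *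
                ((-p k + (p k ^ 2 + q k ^ 2) * x) / ((1 - p k * x) ^ 2 + (q k * x) ^ 2)) -
              aI j * ∑ k, (f j k : ℝ) * (-q k / ((1 - p k * x) ^ 2 + (q k * x) ^ 2))) := by
  classical
  -- complex data: residues `c`, conjugate residues `c'`, `w_k(x)` and `w̄_k(x) = w_{p,−q}(x)`
  set c : Fin A → ℂ := fun k => (γ k : ℂ) + (δ k : ℂ) * I with hc_def
  set c' : Fin A → ℂ := fun k => (γ k : ℂ) + ((-δ k : ℝ) : ℂ) * I with hc'_def
  set W : Fin A → ℝ → ℂ := fun k x => (1 : ℂ) - ((p k : ℂ) + (q k : ℂ) * I) * (x : ℂ) with hW_def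
  set W' : Fin A → ℝ → ℂ := fun k x => (1 : ℂ) - ((p k : ℂ) + ((-q k : ℝ) : ℂ) * I) * (x : ℂ)
    with hW'_def
  have hslit1' : ∀ k, 0 < 1 - p k * 1 ∨ (-q k) * 1 ≠ 0 := fun k => by
    rcases hslit1 k with h | h
    · exact Or.inl h
    · exact Or.inr (by simpa using h)
  have hcc' : ∀ k, c' k = conj (c k) := fun k => (conj_ofReal_add_ofReal_mul_I (γ k) (δ k)).symm
  have hWW' : ∀ k x, W' k x = conj (W k x) := fun k x => (conj_w (p k) (q k) x).symm
  have hlogW' : ∀ k, Complex.log (W' k 1) = conj (Complex.log (W k 1)) := fun k => by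
    rw [hWW' k 1]; exact log_conj_w (hslit1 k)
  set half : ℂ := (((2:ℝ)⁻¹ : ℝ) : ℂ) with hhalf
  have hhalf_alg : IsAlgebraic ℚ half := by
    have : IsAlgebraic ℚ ((2:ℝ)⁻¹) := by
      have h2 : IsAlgebraic ℚ (2:ℝ) := by simpa using isAlgebraic_algebraMap (R := ℚ) (A := ℝ) 2
      exact h2.inv
    exact this.algebraMap
  -- the family of logarithms and coefficients for Baker, indexed by `Fin A ⊕ Fin A`
  set ℓℓ : (Fin A ⊕ Fin A) → ℂ := Sum.elim (fun k => Complex.log (W k 1)) (fun k => Complex.log (W' k 1))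
    with hℓℓ
  set γγ : (Fin A ⊕ Fin A) → ℂ := Sum.elim (fun k => c k * half) (fun k => c' k * half) with hγγ
  have hℓalg : ∀ i, IsAlgebraic ℚ (Complex.exp (ℓℓ i)) := by
    rintro (k | k)
    · simp only [hℓℓ, Sum.elim_inl]
      rw [Complex.exp_log (w_ne_zero (hslit1 k))]
      exact isAlgebraic_w (hp k) (hq k) isAlgebraic_one
    · simp only [hℓℓ, Sum.elim_inr]
      rw [Complex.exp_log (w_ne_zero (hslit1' k))]
      exact isAlgebraic_w (hp k) (hq k).neg isAlgebraic_one
  have hγγalg : ∀ i, IsAlgebraic ℚ (γγ i) := by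
    rintro (k | k)
    · exact (isAlgebraic_ofReal_add_ofReal_mul_I (hγ k) (hδ k)).mul hhalf_alg
    · exact (isAlgebraic_ofReal_add_ofReal_mul_I (hγ k) (hδ k).neg).mul hhalf_alg
  -- the relation in complex form: `r + Σ_i γγ_i ℓℓ_i = 0`
  have hsumC : ∑ i, γγ i * ℓℓ i = ((∑ k, (c k * Complex.log (W k 1)).re : ℝ) : ℂ) := by
    rw [Fintype.sum_sum_type, Complex.ofReal_sum, ← Finset.sum_add_distrib]
    refine Finset.sum_congr rfl fun k _ => ?_
    simp only [hγγ, hℓℓ, Sum.elim_inl, Sum.elim_inr]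
    rw [ofReal_re_eq_add_conj_half, map_mul, ← hcc', ← hlogW']
    ring
  have hrelC : (r : ℂ) + ∑ i, γγ i * ℓℓ i = 0 := by
    rw [hsumC, ← Complex.ofReal_add]
    exact_mod_cast hrel
  -- BAKER
  obtain ⟨hr0, N, hN1, hN2⟩ := baker_decomposition_complex ℓℓ hℓalg hr.algebraMap hγγalg hrelC
  have hr0' : r = 0 := by
    rw [Complex.coe_algebraMap] at hr0
    exact_mod_cast hr0
  refine ⟨hr0', fun j => (γγ j).re, fun j => (γγ j).im,
    fun j k => N j (Sum.inl k) + N j (Sum.inr k), fun j k => N j (Sum.inl k) - N j (Sum.inr k),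
    ?_, ?_, ?_, ?_, ?_⟩
  · -- `aR` algebraic
    have h2 : IsAlgebraic ℚ ((2:ℝ)⁻¹) := by
      have h : IsAlgebraic ℚ (2:ℝ) := by simpa using isAlgebraic_algebraMap (R := ℚ) (A := ℝ) 2
      exact h.inv
    rintro (k | k)
    · have : (γγ (Sum.inl k)).re = γ k * (2:ℝ)⁻¹ := by
        simp only [hγγ, Sum.elim_inl, hc_def, hhalf]
        rw [Complex.re_mul_ofReal]; simp
      dsimp only
      rw [this]; exact (hγ k).mul h2
    · have : (γγ (Sum.inr k)).re = γ k * (2:ℝ)⁻¹ := by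
        simp only [hγγ, Sum.elim_inr, hc'_def, hhalf]
        rw [Complex.re_mul_ofReal]; simp
      dsimp only
      rw [this]; exact (hγ k).mul h2
  · -- `aI` algebraic
    have h2 : IsAlgebraic ℚ ((2:ℝ)⁻¹) := by
      have h : IsAlgebraic ℚ (2:ℝ) := by simpa using isAlgebraic_algebraMap (R := ℚ) (A := ℝ) 2
      exact h.inv
    rintro (k | k)
    · have : (γγ (Sum.inl k)).im = δ k * (2:ℝ)⁻¹ := by
        simp only [hγγ, Sum.elim_inl, hc_def, hhalf]
        rw [Complex.im_mul_ofReal]; simp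
      dsimp only
      rw [this]; exact (hδ k).mul h2
    · have : (γγ (Sum.inr k)).im = -δ k * (2:ℝ)⁻¹ := by
        simp only [hγγ, Sum.elim_inr, hc'_def, hhalf]
        rw [Complex.im_mul_ofReal]; simp
      dsimp only
      rw [this]; exact (hδ k).neg.mul h2
  · -- exact relation among the `log m_k(1)` (real part of `Σ_i N_{ji} ℓℓ_i = 0`)
    intro j
    have h := congrArg Complex.re (hN1 j)
    rw [Complex.re_sum, Fintype.sum_sum_type, Complex.zero_re] at h
    have hre : ∀ k, (Complex.log (W k 1)).re = Real.log ((1 - p k * 1) ^ 2 + (q k * 1) ^ 2) / 2 := by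
      intro k
      rw [Complex.log_re, Complex.norm_eq_sqrt_sq_add_sq, Real.log_sqrt (by positivity)]
      simp [hW_def]
    have hre' : ∀ k, (Complex.log (W' k 1)).re = Real.log ((1 - p k * 1) ^ 2 + (q k * 1) ^ 2) / 2 := by
      intro k
      rw [hlogW', Complex.conj_re, hre]
    have hterm : ∀ k, ((N j (Sum.inl k) : ℂ) * ℓℓ (Sum.inl k)).re + ((N j (Sum.inr k) : ℂ) * ℓℓ (Sum.inr k)).re
        = ((N j (Sum.inl k) + N j (Sum.inr k) : ℚ) : ℝ) *
            Real.log ((1 - p k * 1) ^ 2 + (q k * 1) ^ 2) / 2 := by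
      intro k
      simp only [hℓℓ, Sum.elim_inl, Sum.elim_inr, Complex.mul_re, Complex.ratCast_re,
        Complex.ratCast_im, zero_mul, sub_zero, hre, hre', Rat.cast_add]
      ring
    rw [← Finset.sum_add_distrib] at h
    simp_rw [hterm] at h
    have h2 : ∑ k, ((N j (Sum.inl k) + N j (Sum.inr k) : ℚ) : ℝ) *
        Real.log ((1 - p k * 1) ^ 2 + (q k * 1) ^ 2) =
        2 * ∑ k, ((N j (Sum.inl k) + N j (Sum.inr k) : ℚ) : ℝ) *
          Real.log ((1 - p k * 1) ^ 2 + (q k * 1) ^ 2) / 2 := by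
      rw [Finset.mul_sum]
      exact Finset.sum_congr rfl fun k _ => by ring
    rw [h2, h, mul_zero]
  · -- exact relation among the `arg w_k(1)` (imaginary part)
    intro j
    have h := congrArg Complex.im (hN1 j)
    rw [Complex.im_sum, Fintype.sum_sum_type, Complex.zero_im] at h
    have him : ∀ k, (Complex.log (W k 1)).im = Complex.arg (W k 1) := fun k => Complex.log_im _
    have him' : ∀ k, (Complex.log (W' k 1)).im = -Complex.arg (W k 1) := by
      intro k
      rw [hlogW', Complex.conj_im, him]
    have hterm : ∀ k, ((N j (Sum.inl k) : ℂ) * ℓℓ (Sum.inl k)).im + ((N j (Sum.inr k) : ℂ) * ℓℓ (Sum.inr k)).im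
        = ((N j (Sum.inl k) - N j (Sum.inr k) : ℚ) : ℝ) * Complex.arg (W k 1) := by
      intro k
      simp only [hℓℓ, Sum.elim_inl, Sum.elim_inr, Complex.mul_im, Complex.ratCast_re,
        Complex.ratCast_im, zero_mul, add_zero, him, him', Rat.cast_sub]
      ring
    rw [← Finset.sum_add_distrib] at h
    simp_rw [hterm] at h
    simpa [hW_def] using h
  · -- the decomposition of the polar integrand
    intro x hx
    have hx' : ∀ k, 0 < 1 - p k * x ∨ (-q k) * x ≠ 0 := fun k => by
      rcases hx k with h | h
      · exact Or.inl h
      · exact Or.inr (by simpa using h)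
    set D : Fin A → ℂ := fun k => -((p k : ℂ) + (q k : ℂ) * I) / W k x with hD_def
    set D' : Fin A → ℂ := fun k => -((p k : ℂ) + ((-q k : ℝ) : ℂ) * I) / W' k x with hD'_def
    have hDD' : ∀ k, D' k = conj (D k) := by
      intro k
      simp only [hD_def, hD'_def, map_div₀, map_neg, hWW']
      congr 2
      exact (conj_ofReal_add_ofReal_mul_I (p k) (q k)).symm
    set DD : (Fin A ⊕ Fin A) → ℂ := Sum.elim D D' with hDD
    set E : (Fin A ⊕ Fin A) → ℂ := fun j => ∑ i, (N j i : ℂ) * DD i with hE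
    -- (i) the left-hand side is `Re Σ_k c_k D_k`
    have hLHS : (∑ k, (γ k * (-p k + (p k ^ 2 + q k ^ 2) * x) + δ k * q k) /
        ((1 - p k * x) ^ 2 + (q k * x) ^ 2)) = ∑ k, (c k * D k).re :=
      Finset.sum_congr rfl fun k _ => (re_residue_term (γ k) (δ k) (hx k)).symm
    -- (ii) `Σ_i γγ_i DD_i = Σ_k Re(c_k D_k)` (as complex numbers)
    have hS1 : ∑ i, γγ i * DD i = ((∑ k, (c k * D k).re : ℝ) : ℂ) := by
      rw [Fintype.sum_sum_type, Complex.ofReal_sum, ← Finset.sum_add_distrib]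
      refine Finset.sum_congr rfl fun k _ => ?_
      simp only [hγγ, hDD, Sum.elim_inl, Sum.elim_inr]
      rw [ofReal_re_eq_add_conj_half, map_mul, ← hcc', ← hDD']
      ring
    -- (iii) `Σ_i γγ_i DD_i = Σ_j γγ_j E_j` by the Baker decomposition of `γγ`
    have hS2 : ∑ i, γγ i * DD i = ∑ j, γγ j * E j := by
      calc ∑ i, γγ i * DD i = ∑ i, (∑ j, γγ j * (N j i : ℂ)) * DD i :=
            Finset.sum_congr rfl fun i _ => by rw [← hN2 i]
        _ = ∑ i, ∑ j, γγ j * (N j i : ℂ) * DD i :=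
            Finset.sum_congr rfl fun i _ => by rw [Finset.sum_mul]
        _ = ∑ j, ∑ i, γγ j * (N j i : ℂ) * DD i := Finset.sum_comm
        _ = ∑ j, γγ j * E j := Finset.sum_congr rfl fun j _ => by
            rw [hE, Finset.mul_sum]
            exact Finset.sum_congr rfl fun i _ => by ring
    -- (iv) real and imaginary parts of `E_j`
    have hDre : ∀ k, (D k).re = (-p k + (p k ^ 2 + q k ^ 2) * x) / ((1 - p k * x) ^ 2 + (q k * x) ^ 2) :=
      fun k => re_neg_nu_div_w (hx k)
    have hDim : ∀ k, (D k).im = -q k / ((1 - p k * x) ^ 2 + (q k * x) ^ 2) :=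
      fun k => im_neg_nu_div_w (hx k)
    have hEre : ∀ j, (E j).re = ∑ k, ((N j (Sum.inl k) + N j (Sum.inr k) : ℚ) : ℝ) *
        ((-p k + (p k ^ 2 + q k ^ 2) * x) / ((1 - p k * x) ^ 2 + (q k * x) ^ 2)) := by
      intro j
      rw [hE, Complex.re_sum, Fintype.sum_sum_type, ← Finset.sum_add_distrib]
      refine Finset.sum_congr rfl fun k _ => ?_
      simp only [hDD, Sum.elim_inl, Sum.elim_inr, Complex.mul_re, Complex.ratCast_re,
        Complex.ratCast_im, zero_mul, sub_zero, hDD', Complex.conj_re, hDre, Rat.cast_add]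
      ring
    have hEim : ∀ j, (E j).im = ∑ k, ((N j (Sum.inl k) - N j (Sum.inr k) : ℚ) : ℝ) *
        (-q k / ((1 - p k * x) ^ 2 + (q k * x) ^ 2)) := by
      intro j
      rw [hE, Complex.im_sum, Fintype.sum_sum_type, ← Finset.sum_add_distrib]
      refine Finset.sum_congr rfl fun k _ => ?_
      simp only [hDD, Sum.elim_inl, Sum.elim_inr, Complex.mul_im, Complex.ratCast_re,
        Complex.ratCast_im, zero_mul, add_zero, hDD', Complex.conj_im, hDim, Rat.cast_sub]
      ring
    -- (v) assemble
    have key : (∑ k, (c k * D k).re) = ∑ j, ((γγ j).re * (E j).re - (γγ j).im * (E j).im) := by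
      have h := congrArg Complex.re (hS1.symm.trans hS2)
      rw [Complex.ofReal_re, Complex.re_sum] at h
      rw [h]
      exact Finset.sum_congr rfl fun j _ => by rw [Complex.mul_re]
    rw [hLHS, key]
    refine Finset.sum_congr rfl fun j _ => ?_
    rw [hEre, hEim]

end KZ.BakerSectorComplex

end Literature.NumberTheory.Transcendental
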